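import Summits.KontsevichZagierPeriods.KontsevichZagierPeriods.Theses.FurushoPentagon
import Summits.KontsevichZagierPeriods.KontsevichZagierPeriods.Theorems.FurushoPentagonReducedPeriodRingDefs
import Summits.KontsevichZagierPeriods.KontsevichZagierPeriods.Theorems.FurushoPentagonReducedPeriodRingCubeMerge
import Literature.NumberTheory.Transcendental.KZCubicalCalculus
import Literature.NumberTheory.Transcendental.KZProductIdeal
import Literature.NumberTheory.Transcendental.KZRulesAssociator
import Literature.NumberTheory.Transcendental.AyoubPeriodSeries

/-!
# `SectorToKernel` (stmt-KontsevichZagierPeriods-10813), line `effective-cube-surjection`: proof skeleton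

Lead prover's skeleton, reconstructed from the stub registry of the planner's checked skeleton
`line-effective-cube-surjection.lean` (its tree mirror was never written; the six stub signatures
below are byte-identical with the registered ones, `ledger workitem archive … --key stubs`).

The crux `FurushoPentagon.SectorToKernel` is
`StuffleInKZ → HoffmanRelationInKZ → ∀ c, KZ.eval c = 0 → c ∈ KZ.relations`; its conclusion is the
kernel form of Kontsevich–Zagier's Conjecture 1 (`Cruxes/SectorToKernel/Disproof.lean`,
`kernelForm_iff_summit`), so the line is a CONDITIONAL BRIDGE: it derives the kernel form from

* S1 `stub_cubeResolution` (XL, rules-side, transcendence-free; byte-identical with stub S1b of the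
  sibling crux `ReducedPeriodRing` (stmt-3929), line `effective-end-monoid`, over the landed
  vocabulary `Theorems/FurushoPentagonReducedPeriodRingDefs.lean`): every representation is, modulo
  the KZ relations, a `ℤ`-combination of tame cube classes;
* S2 `stub_admissibleOfTame` (L/XL): a tame cube class is equivalent to an Ayoub-ADMISSIBLE cube
  representation (integrand = sum on the closed cube of a real power series of polyradius `> 1`,
  algebraic over `ℚ[x]`) — dyadic subdivision `KZ.cubicalSubdivGens_subset_relations` + re-summing;
* S3 `stub_realStokesForm` (XL): Ayoub's effective cube conjecture, stated over the tree's honest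
  complex vocabulary `AyoubRel.Oan / intC / relAC / kSpan`, transported to REAL admissible cube data:
  an admissible cube representation of integral `0` is, after padding by `d` dummy variables, a finite
  sum of real Stokes elements `∂ᵢH − H|_{xᵢ=1} + H|_{xᵢ=0}` with `H` analytic near the cube and
  algebraic over `ℚ[x]`;
* S4 `stub_semialgebraicOfAlgebraic` (L): analytic + algebraic over `ℚ[x]` on the cube ⇒
  `ℚ`-semialgebraic on the cube (root selection over a cylindrical decomposition);
* S5 `stub_stokesSpanCalibration` (M): a cube representation whose integrand is a finite sum of Stokes
  elements along arbitrary coordinates is a KZ relation (Newton–Leibniz along the last coordinate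
  `KZ.cubicalStokesGens_subset_relations`, a transposition `KZ.cubicalCovGens_subset_relations`, slabs,
  integrand additivity);
* S6 `stub_ayoubEffectiveCubeKernel` — THE LEAF: J. Ayoub, Ann. of Math. 181 (2015), Conj. 1.1 over
  `k = ℚ` (the kernel of `∫_{[0,1]^∞}` on `𝒪_{ℚ-alg}(𝔻̄^∞)` is the `ℚ`-span of the Stokes elements);
  OPEN, period-conjecture strength (its `⊇` half is the tree theorem `AyoubRel.intC_relAC_eq_zero`).

Composition (`SectorToKernel_of`, proved below from the six stubs and the LANDED merging theorem
`ReducedPeriodRing.stub_cubeMerge`): `c ∈ ker eval` ⇒ `c ∼ a ∈ cubicalSpan` (S1) ⇒ `a ∼ [r]` one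
tame cube class (`stub_cubeMerge`) ⇒ `[r] ∼ [s]` admissible (S2) ⇒ `∫_{[0,1]ⁿ} s = eval c = 0`
(soundness) ⇒ `s ∘ pr = Σⱼ Stokesⱼ(Hⱼ)` on `[0,1]ⁿ⁺ᵈ` (S3 fed with S6) with `Hⱼ` semialgebraic (S4)
⇒ the padded class `[s] · [[0,1]ᵈ, 1] ∼ [s]` (Fubini product with the unit cube, two-sided unit
modulo relations) is a relation (S5) ⇒ `c ∈ relations`. The hypotheses `StuffleInKZ`,
`HoffmanRelationInKZ` are not used (Disproof §4: they are outputs of the conclusion).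
-/

noncomputable section

namespace Summit.KontsevichZagierPeriods.FurushoPentagon.SectorToKernel

open Set MeasureTheory
open Literature.NumberTheory.Transcendental
open Literature.NumberTheory.Transcendental.KZ hiding cubicalSpan
open Summit.KontsevichZagierPeriods.KontsevichZagierPeriods.Theses.FurushoPentagon
open Summit.KontsevichZagierPeriods.FurushoPentagon.ReducedPeriodRing (unitCube cubicalGens cubicalSpan
  stub_cubeMerge)

/-! ## Registered stubs (signatures byte-identical with the registry of the planner's skeleton) -/

/-- **S5 (Stokes span calibration).** A cube representation whose integrand is a finite sum of real
Stokes elements `∂_{i j} Hⱼ − Hⱼ|_{x_{i j}=1} + Hⱼ|_{x_{i j}=0}` (tame `Hⱼ`) is a KZ relation.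
[Ayoub 2014, Def. 10; Kontsevich–Zagier 2001, §1.2 rules (1)–(3)] -/
theorem stub_stokesSpanCalibration :
    ∀ (M : ℕ) (t : IntegralRep M), t.domain = KZ.cube M → ∀ (k : ℕ) (i : Fin k → Fin M) (H : Fin k → (Fin M → ℝ) → ℝ), (∀ j, AnalyticOnNhd ℝ (H j) (KZ.cube M) ∧ IsSemialgebraicFunOn ℚ (KZ.cube M) (H j)) → (∀ z ∈ KZ.cube M, t.integrand z = ∑ j, (fderiv ℝ (H j) z (Pi.single (i j) 1) - H j (Function.update z (i j) 1) + H j (Function.update z (i j) 0))) → of t ∈ relations := by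
  sorry

/-- **S4 (analytic + algebraic ⇒ semialgebraic on the cube).** [Bochnak–Coste–Roy 1998, Prop. 8.1.8
and §2.2] -/
theorem stub_semialgebraicOfAlgebraic :
    ∀ (M : ℕ) (H : (Fin M → ℝ) → ℝ), AnalyticOnNhd ℝ H (KZ.cube M) → (∃ P : Polynomial (MvPolynomial (Fin M) ℚ), P ≠ 0 ∧ ∀ x ∈ KZ.cube M, Polynomial.eval₂ (MvPolynomial.aeval x : MvPolynomial (Fin M) ℚ →ₐ[ℚ] ℝ).toRingHom (H x) P = 0) → IsSemialgebraicFunOn ℚ (KZ.cube M) H := by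
  sorry

/-- **S3 (Ayoub's effective conjecture transported to real admissible cube data).**
[Ayoub 2015, Conj. 1.1; Ayoub 2014, Def. 9–10, Rem. 13] -/
theorem stub_realStokesForm :
    (∀ F ∈ AyoubRel.Oan (Rat.castHom ℂ), AyoubRel.intC F = 0 → F ∈ AyoubRel.kSpan (Rat.castHom ℂ) {x : AyoubRel.CSeries | ∃ G ∈ AyoubRel.Oan (Rat.castHom ℂ), ∃ i : ℕ, x = AyoubRel.relAC i G}) → ∀ (m : ℕ) (s : IntegralRep m), s.domain = KZ.cube m → (∃ (F : MvPowerSeries (Fin m) ℝ) (ρ : ℝ), 1 < ρ ∧ Summable (fun a : Fin m →₀ ℕ => |MvPowerSeries.coeff a F| * ρ ^ (a.sum fun _ e => e)) ∧ (∀ x ∈ KZ.cube m, HasSum (fun a : Fin m →₀ ℕ => MvPowerSeries.coeff a F * a.prod (fun j e => x j ^ e)) (s.integrand x)) ∧ ∃ P : Polynomial (MvPolynomial (Fin m) ℚ), P ≠ 0 ∧ ∀ x ∈ KZ.cube m, Polynomial.eval₂ (MvPolynomial.aeval x : MvPolynomial (Fin m) ℚ →ₐ[ℚ] ℝ).toRingHom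 (s.integrand x) P = 0) → ∫ x in KZ.cube m, s.integrand x = 0 → ∃ (d k : ℕ) (i : Fin k → Fin (m + d)) (H : Fin k → (Fin (m + d) → ℝ) → ℝ), (∀ j, AnalyticOnNhd ℝ (H j) (KZ.cube (m + d)) ∧ ∃ P : Polynomial (MvPolynomial (Fin (m + d)) ℚ), P ≠ 0 ∧ ∀ x ∈ KZ.cube (m + d), Polynomial.eval₂ (MvPolynomial.aeval x : MvPolynomial (Fin (m + d)) ℚ →ₐ[ℚ] ℝ).toRingHom (H j x) P = 0) ∧ ∀ z ∈ KZ.cube (m + d), s.integrand (fun a => z (Fin.castAdd d a)) = ∑ j, (fderiv ℝ (H j) z (Pi.single (i j) 1) - H j (Function.update z (i j) 1) + H j (Function.update z (i j) 0)) := by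
  sorry

/-- **S2 (tame ⇒ admissible).** [Ayoub 2014, Def. 9 and Rem. 12; Kontsevich–Zagier 2001, §1.2] -/
theorem stub_admissibleOfTame :
    ∀ (n : ℕ) (r : IntegralRep n), r.domain = KZ.cube n → AnalyticOnNhd ℝ r.integrand (KZ.cube n) → ∃ s : IntegralRep n, s.domain = KZ.cube n ∧ (∃ (F : MvPowerSeries (Fin n) ℝ) (ρ : ℝ), 1 < ρ ∧ Summable (fun a : Fin n →₀ ℕ => |MvPowerSeries.coeff a F| * ρ ^ (a.sum fun _ e => e)) ∧ (∀ x ∈ KZ.cube n, HasSum (fun a : Fin n →₀ ℕ => MvPowerSeries.coeff a F * a.prod (fun j e => x j ^ e)) (s.integrand x)) ∧ ∃ P : Polynomial (MvPolynomial (Fin n) ℚ), P ≠ 0 ∧ ∀ x ∈ KZ.cube n, Polynomial.eval₂ (MvPolynomial.aeval x : MvPolynomial (Fin n) ℚ →ₐ[ℚ] ℝ).toRingHom (s.integrand x) P = 0) ∧ of r - of s ∈ relations := by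
  sorry

/-- **S1 (resolution / compilation; shared with crux 3929 S1b).** Every integral representation is,
modulo the KZ relations, a `ℤ`-combination of tame cube classes.
[Ayoub 2014, Rem. 12; Viu-Sos 2021, Thm. 1.1] -/
theorem stub_cubeResolution :
    ∀ (N : ℕ) (u : IntegralRep N), ∃ c : FormalRep, c ∈ cubicalSpan ∧ of u - c ∈ relations := by
  sorry

/-- **S6 — the leaf: Ayoub's effective cube conjecture over `k = ℚ`.** The kernel of
`∫_{[0,1]^∞}` on `𝒪_{ℚ-alg}(𝔻̄^∞)` is the `ℚ`-span of the Stokes elements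
`∂G/∂zᵢ − G|_{zᵢ=1} + G|_{zᵢ=0}`. OPEN (period-conjecture strength).
[Ayoub, Ann. of Math. 181 (2015), Conj. 1.1] -/
theorem stub_ayoubEffectiveCubeKernel :
    ∀ F ∈ AyoubRel.Oan (Rat.castHom ℂ), AyoubRel.intC F = 0 → F ∈ AyoubRel.kSpan (Rat.castHom ℂ) {x : AyoubRel.CSeries | ∃ G ∈ AyoubRel.Oan (Rat.castHom ℂ), ∃ i : ℕ, x = AyoubRel.relAC i G} := by
  sorry

/-! ## Glue (proved) -/

/-- `unitCube n` is, by definition, `KZ.cube n`. [folklore] -/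
theorem unitCube_eq_cube (n : ℕ) : unitCube n = KZ.cube n := rfl

/-- **Cube normal form** from S1: every formal combination is, modulo the KZ relations, a
`ℤ`-combination of tame cube classes. [Ayoub 2014, Rem. 12] -/
theorem cubeNormalForm (c : FormalRep) : ∃ a ∈ cubicalSpan, c - a ∈ relations := by
  induction c using FreeAbelianGroup.induction_on with
  | zero => exact ⟨0, cubicalSpan.zero_mem, by simp⟩
  | of x =>
    obtain ⟨n, u⟩ := x
    obtain ⟨a, ha, hua⟩ := stub_cubeResolution n u
    exact ⟨a, ha, hua⟩
  | neg x ih =>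
    obtain ⟨a, ha, hxa⟩ := ih
    refine ⟨-a, cubicalSpan.neg_mem ha, ?_⟩
    have : -FreeAbelianGroup.of x - -a = -(FreeAbelianGroup.of x - a) := by abel
    rw [this]
    exact relations.neg_mem hxa
  | add x y hx hy =>
    obtain ⟨a, ha, hxa⟩ := hx
    obtain ⟨b, hb, hyb⟩ := hy
    refine ⟨a + b, cubicalSpan.add_mem ha hb, ?_⟩
    have : x + y - (a + b) = (x - a) + (y - b) := by abel
    rw [this]
    exact relations.add_mem hxa hyb

/-- The constant cube representation `[[0,1]ᵈ, 1]` (analytic, `ℚ`-semialgebraic). [Ayoub 2014, Def. 10] -/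
theorem exists_oneCube (d : ℕ) :
    ∃ u : IntegralRep d, u.domain = KZ.cube d ∧ u.integrand = fun _ => 1 := by
  have h1 : IsSemialgebraicFunOn ℚ (KZ.cube d) (fun _ : Fin d → ℝ => (1 : ℝ)) := by
    simpa using isSemialgebraicFunOn_aeval (R := ℝ) KZ.isSemialgebraic_cube
      (1 : MvPolynomial (Fin d) ℚ)
  exact ⟨IntegralRep.tameCube (fun _ => (1 : ℝ)) analyticOnNhd_const h1, rfl, rfl⟩

/-- **`[[0,1]ᵈ, 1] ∼ [pt, 1]`** by `d` Newton–Leibniz moves along the last coordinate of the cube with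
the primitive `F (x, t) = t`. [Kontsevich–Zagier 2001, §1.2 rule (3)] -/
theorem oneCube_sub_unit : ∀ (d : ℕ) (u : IntegralRep d), u.domain = KZ.cube d →
    u.integrand = (fun _ => 1) → of u - of IntegralRep.unit ∈ relations := by
  intro d
  induction d with
  | zero =>
    intro u hd hi
    have hu : u = IntegralRep.unit :=
      IntegralRep.ext' (by rw [hd, IntegralRep.unit_domain, KZ.cube_zero])
        (by rw [hi, IntegralRep.unit_integrand])
    rw [hu, sub_self]
    exact relations.zero_mem
  | succ d ih =>
    intro u hd hi
    obtain ⟨u', hd', hi'⟩ := exists_oneCube d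
    have hua : AnalyticOnNhd ℝ u.integrand (KZ.cube (d + 1)) := by
      rw [hi]; exact analyticOnNhd_const
    have hua' : AnalyticOnNhd ℝ u'.integrand (KZ.cube d) := by
      rw [hi']; exact analyticOnNhd_const
    have hFa : AnalyticOnNhd ℝ (fun z : Fin (d + 1) → ℝ => z (Fin.last d)) (KZ.cube (d + 1)) :=
      (ContinuousLinearMap.proj (R := ℝ) (φ := fun _ : Fin (d + 1) => ℝ)
        (Fin.last d)).analyticOnNhd _
    have hmove : of u - of u' ∈ KZ.cubicalStokesGens := by
      refine KZ.mem_cubicalStokesGens (F := fun z => z (Fin.last d)) ⟨hd, hua⟩ ⟨hd', hua'⟩ hFa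
        (isSemialgebraicFunOn_apply KZ.isSemialgebraic_cube (Fin.last d)) ?_ ?_
      · intro x _ t _
        rw [hi]
        simp only [Fin.snoc_last]
        exact hasDerivAt_id' t
      · intro x _
        simp [hi']
    have h1 : of u - of u' ∈ relations := KZ.cubicalStokesGens_subset_relations hmove
    have h2 : of u' - of IntegralRep.unit ∈ relations := ih u' hd' hi'
    have : of u - of IntegralRep.unit = (of u - of u') + (of u' - of IntegralRep.unit) := by abel
    rw [this]
    exact relations.add_mem h1 h2

/-- **Padding by dummy variables**: `[s] ∼ [s] · [[0,1]ᵈ, 1]` (right unit modulo relations and the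
two-sided ideal property). [Kontsevich–Zagier 2001, §4.1] -/
theorem of_sub_of_prod_oneCube {m d : ℕ} (s : IntegralRep m) (u : IntegralRep d)
    (hud : u.domain = KZ.cube d) (hui : u.integrand = fun _ => 1) :
    of s - of (s.prod u) ∈ relations := by
  have h0 : of IntegralRep.unit - of u ∈ relations := by
    rw [← neg_sub]; exact relations.neg_mem (oneCube_sub_unit d u hud hui)
  have h1 : of s * of IntegralRep.unit - of s * of u ∈ relations :=
    mul_sub_mul_mem_relations (by rw [sub_self]; exact relations.zero_mem) h0
  have h2 : of s * of IntegralRep.unit - of s ∈ relations := mul_of_unit_sub_mem_relations (of s)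
  have : of s - of (s.prod u) =
      (of s * of IntegralRep.unit - of s * of u) - (of s * of IntegralRep.unit - of s) := by
    rw [← of_mul_of]; abel
  rw [this]
  exact relations.sub_mem h1 h2

/-- The product of two cube domains is the cube. [folklore] -/
theorem prodDomain_eq_cube {m d : ℕ} (s : IntegralRep m) (u : IntegralRep d)
    (hs : s.domain = KZ.cube m) (hu : u.domain = KZ.cube d) :
    IntegralRep.prodDomain s u = KZ.cube (m + d) := by
  ext z
  simp only [IntegralRep.mem_prodDomain, hs, hu, KZ.mem_cube]
  constructor
  · rintro ⟨h1, h2⟩ i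
    induction i using Fin.addCases with
    | left i => simpa using h1 i
    | right j => simpa using h2 j
  · intro h
    exact ⟨fun i => h _, fun j => h _⟩

/-- The integrand of the padded representation is `s ∘ pr`. [folklore] -/
theorem prod_oneCube_integrand {m d : ℕ} (s : IntegralRep m) (u : IntegralRep d)
    (hui : u.integrand = fun _ => 1) (z : Fin (m + d) → ℝ) :
    (s.prod u).integrand z = s.integrand (fun a => z (Fin.castAdd d a)) := by
  rw [IntegralRep.prod_integrand_eq, IntegralRep.prodFun_apply, hui, mul_one]

/-- The value of a cube representation is `∫_{[0,1]ⁿ}` of its integrand. [folklore] -/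
theorem eval_of_eq_setIntegral_cube {m : ℕ} (s : IntegralRep m) (hs : s.domain = KZ.cube m) :
    eval (of s) = ∫ x in KZ.cube m, s.integrand x := by
  rw [eval_of, IntegralRep.value, hs]

/-! ## The crux -/

/-- **`SectorToKernel`** from the six stubs of line `effective-cube-surjection` (the two hypotheses of
the crux are not used). [Ayoub 2015, Conj. 1.1; Ayoub 2014, Rem. 12–13; Kontsevich–Zagier 2001, §1.2] -/
theorem SectorToKernel_of : SectorToKernel := by
  intro _ _ c hc
  -- (1) cube normal form and (2) merging: `c ∼ [r]`, `r` a tame cube class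
  obtain ⟨a, ha, hca⟩ := cubeNormalForm c
  obtain ⟨n, r, hrd, hra, har⟩ := stub_cubeMerge a ha
  rw [unitCube_eq_cube] at hrd hra
  -- (3) `[r] ∼ [s]`, `s` Ayoub-admissible
  obtain ⟨s, hsd, hadm, hrs⟩ := stub_admissibleOfTame n r hrd hra
  have hcs : c - of s ∈ relations := by
    have := relations.add_mem (relations.add_mem hca har) hrs
    simpa using this
  -- (4) `∫_{[0,1]ⁿ} s = eval c = 0`
  have hs0 : ∫ x in KZ.cube n, s.integrand x = 0 := by
    have h1 : eval (c - of s) = 0 := relations_le_ker_eval_holds hcs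
    rw [map_sub, hc, zero_sub, neg_eq_zero, eval_of_eq_setIntegral_cube s hsd] at h1
    exact h1
  -- (5) real Stokes form of the padded integrand, from the leaf
  obtain ⟨d, k, i, H, hH, hid⟩ :=
    stub_realStokesForm stub_ayoubEffectiveCubeKernel n s hsd hadm hs0
  -- (6) the `Hⱼ` are `ℚ`-semialgebraic on the cube
  have hHs : ∀ j, AnalyticOnNhd ℝ (H j) (KZ.cube (n + d)) ∧
      IsSemialgebraicFunOn ℚ (KZ.cube (n + d)) (H j) :=
    fun j => ⟨(hH j).1, stub_semialgebraicOfAlgebraic (n + d) (H j) (hH j).1 (hH j).2⟩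
  -- (7) pad `s` by `d` dummy variables and calibrate
  obtain ⟨u, hud, hui⟩ := exists_oneCube d
  have htd : (s.prod u).domain = KZ.cube (n + d) := by
    rw [IntegralRep.prod_domain, prodDomain_eq_cube s u hsd hud]
  have hti : ∀ z ∈ KZ.cube (n + d), (s.prod u).integrand z =
      ∑ j, (fderiv ℝ (H j) z (Pi.single (i j) 1) - H j (Function.update z (i j) 1) +
        H j (Function.update z (i j) 0)) := by
    intro z hz
    rw [prod_oneCube_integrand s u hui z]
    exact hid z hz
  have ht : of (s.prod u) ∈ relations :=
    stub_stokesSpanCalibration (n + d) (s.prod u) htd k i H hHs hti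
  have hst : of s - of (s.prod u) ∈ relations := of_sub_of_prod_oneCube s u hud hui
  have : c = (c - of s) + (of s - of (s.prod u)) + of (s.prod u) := by abel
  rw [this]
  exact relations.add_mem (relations.add_mem hcs hst) ht

end Summit.KontsevichZagierPeriods.FurushoPentagon.SectorToKernel
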